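import Literature.Analysis.PDE.ABPContactSet
import Mathlib.Analysis.Calculus.DerivativeTest
import HarnessLib

/-!
# The Hessian is negative semidefinite on the upper contact set (Gilbarg–Trudinger, §9.1)

On the upper contact set `Γ⁺` the graph of `u` lies below its tangent plane, so for twice
differentiable `u` the Hessian is negative semidefinite there — the fact that lets
Gilbarg–Trudinger apply the determinant–trace inequality to `−D²u ≥ 0` in Lemma 9.3.

* `deriv_deriv_nonpos_of_isLocalMax` — the one-variable second-order necessary condition:
  a local maximum with `f' = 0` has `f'' ≤ 0` (if `f'' > 0` the point would also be a local
  minimum, Mathlib's `isLocalMin_of_deriv_deriv_pos`, forcing `f` to be locally constant);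
* `hessian_apply_self_nonpos_of_mem_upperContactSet` — `D²u(y)(v, v) ≤ 0` for `y ∈ Γ⁺`.

## References

* D. Gilbarg, N. S. Trudinger, *Elliptic Partial Differential Equations of Second Order* (2001),
  §9.1 ("since `u` is `C²`, `D²u ≤ 0` on `Γ⁺`"). [GilbargTrudinger2001]
-/

noncomputable section

open Set Metric Filter RealInnerProductSpace
open scoped Topology

namespace Literature.Analysis.PDE.ABP

/-! ### One variable: a local maximum has nonpositive second derivative -/

/-- **Second-order necessary condition**: if `f` has a local maximum at `x₀`, is continuous there
and `f'(x₀) = 0`, then `f''(x₀) ≤ 0` (`deriv (deriv f) x₀ ≤ 0`, with Mathlib's convention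
`deriv = 0` where not differentiable). [folklore] -/
theorem deriv_deriv_nonpos_of_isLocalMax {f : ℝ → ℝ} {x₀ : ℝ} (hmax : IsLocalMax f x₀)
    (hd : deriv f x₀ = 0) (hc : ContinuousAt f x₀) : deriv (deriv f) x₀ ≤ 0 := by
  by_contra hpos
  push Not at hpos
  have hmin : IsLocalMin f x₀ := isLocalMin_of_deriv_deriv_pos hpos hd hc
  -- `f` is locally constant, so `deriv f = 0` near `x₀` and `deriv (deriv f) x₀ = 0`
  have hconst : ∀ᶠ x in 𝓝 x₀, f x = f x₀ :=
    (hmax.and hmin).mono fun x hx ↦ le_antisymm hx.1 hx.2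
  obtain ⟨ε, hε, hball⟩ := Metric.eventually_nhds_iff.1 hconst
  have hderiv : ∀ᶠ x in 𝓝 x₀, deriv f x = 0 := by
    refine Metric.eventually_nhds_iff.2 ⟨ε, hε, fun x hx ↦ ?_⟩
    have hloc : f =ᶠ[𝓝 x] fun _ ↦ f x₀ := by
      have hxmem : ball x₀ ε ∈ 𝓝 x := isOpen_ball.mem_nhds hx
      exact Filter.eventually_of_mem hxmem fun z hz ↦ hball hz
    rw [hloc.deriv_eq, deriv_const]
  have h0 : deriv (deriv f) x₀ = 0 := by
    have hloc : deriv f =ᶠ[𝓝 x₀] fun _ ↦ (0 : ℝ) := hderiv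
    rw [hloc.deriv_eq, deriv_const]
  linarith

/-! ### The Hessian on the upper contact set -/

variable {E : Type*} [NormedAddCommGroup E] [InnerProductSpace ℝ E] [CompleteSpace E]

/-- **`D²u(y)(v,v) ≤ 0` on the upper contact set.** For `y ∈ Γ⁺`, `u` differentiable on the open
`Ω` and `Du` differentiable at `y`, the second derivative is negative semidefinite:
`g(t) = u(y + tv) − t⟪∇u(y), v⟫` has a local maximum at `t = 0` with `g'(0) = 0` and
`g''(0) = D²u(y)(v,v)`. [cite: GilbargTrudinger2001, §9.1] -/
theorem hessian_apply_self_nonpos_of_mem_upperContactSet {Ω : Set E} (hΩo : IsOpen Ω)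
    {u : E → ℝ} (hdiff : ∀ x ∈ Ω, DifferentiableAt ℝ u x) {y : E}
    (hy : y ∈ upperContactSet u Ω) (hD2 : DifferentiableAt ℝ (fderiv ℝ u) y) (v : E) :
    fderiv ℝ (fderiv ℝ u) y v v ≤ 0 := by
  have hyΩ : y ∈ Ω := hy.1
  -- the line `t ↦ y + t v` stays in `Ω` for small `t`
  have hline : ContinuousAt (fun t : ℝ ↦ y + t • v) 0 :=
    (continuous_const.add (continuous_id.smul continuous_const)).continuousAt
  have hev : ∀ᶠ t in 𝓝 (0 : ℝ), y + t • v ∈ Ω := by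
    have : y + (0 : ℝ) • v ∈ Ω := by simpa using hyΩ
    exact hline.preimage_mem_nhds (hΩo.mem_nhds this)
  set g : ℝ → ℝ := fun t ↦ u (y + t • v) - t * ⟪gradient u y, v⟫ with hg
  -- local maximum at `0` from the contact inequality
  have hmax : IsLocalMax g 0 := by
    refine hev.mono fun t ht ↦ ?_
    have h := hy.2 _ ht
    simp only [hg, zero_smul, add_zero, zero_mul, sub_zero, add_sub_cancel_left, inner_smul_right]
      at h ⊢
    linarith
  -- derivative of `g` near `0`
  have hderiv_at : ∀ t, y + t • v ∈ Ω →
      HasDerivAt g (fderiv ℝ u (y + t • v) v - ⟪gradient u y, v⟫) t := fun t ht ↦ by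
    have hl : HasDerivAt (fun t : ℝ ↦ y + t • v) v t := by
      simpa using ((hasDerivAt_id t).smul_const v).const_add y
    have hu : HasFDerivAt u (fderiv ℝ u (y + t • v)) (y + t • v) := (hdiff _ ht).hasFDerivAt
    have h1 : HasDerivAt (fun t : ℝ ↦ u (y + t • v)) (fderiv ℝ u (y + t • v) v) t :=
      hu.comp_hasDerivAt t hl
    have h2 : HasDerivAt (fun t : ℝ ↦ t * ⟪gradient u y, v⟫) ⟪gradient u y, v⟫ t := by
      simpa using (hasDerivAt_id t).mul_const ⟪gradient u y, v⟫
    exact h1.sub h2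
  have hderiv_eq : ∀ᶠ t in 𝓝 (0 : ℝ), deriv g t = fderiv ℝ u (y + t • v) v - ⟪gradient u y, v⟫ :=
    hev.mono fun t ht ↦ (hderiv_at t ht).deriv
  have hg0 : deriv g 0 = 0 := by
    rw [(hderiv_at 0 (by simpa using hyΩ)).deriv]
    have h0 : y + (0 : ℝ) • v = y := by rw [zero_smul, add_zero]
    rw [h0, sub_eq_zero, gradient, InnerProductSpace.toDual_symm_apply]
  -- second derivative at `0`
  have hD : HasDerivAt (fun t : ℝ ↦ fderiv ℝ u (y + t • v) v - ⟪gradient u y, v⟫)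
      (fderiv ℝ (fderiv ℝ u) y v v) 0 := by
    have hl : HasDerivAt (fun t : ℝ ↦ y + t • v) v 0 := by
      simpa using ((hasDerivAt_id (0 : ℝ)).smul_const v).const_add y
    have hF : HasFDerivAt (fderiv ℝ u) (fderiv ℝ (fderiv ℝ u) y) (y + (0 : ℝ) • v) := by
      simpa using hD2.hasFDerivAt
    have h1 : HasDerivAt (fun t : ℝ ↦ fderiv ℝ u (y + t • v)) (fderiv ℝ (fderiv ℝ u) y v) 0 :=
      hF.comp_hasDerivAt (0 : ℝ) hl
    have h2 : HasDerivAt (fun t : ℝ ↦ fderiv ℝ u (y + t • v) v) (fderiv ℝ (fderiv ℝ u) y v v) 0 :=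
      (ContinuousLinearMap.apply ℝ ℝ v).hasFDerivAt.comp_hasDerivAt (0 : ℝ) h1
    simpa using h2.sub_const ⟪gradient u y, v⟫
  have hdd : deriv (deriv g) 0 = fderiv ℝ (fderiv ℝ u) y v v := by
    have h := (Filter.EventuallyEq.hasDerivAt_iff hderiv_eq).2 hD
    exact h.deriv
  have hc : ContinuousAt g 0 := (hderiv_at 0 (by simpa using hyΩ)).continuousAt
  have := deriv_deriv_nonpos_of_isLocalMax hmax hg0 hc
  rwa [hdd] at this

end Literature.Analysis.PDE.ABP

end
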